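import Summits.QuantumFields.GaugeBoot.MonotoneEnvelope
import HarnessLib

/-!
# Gauge-boot: the weak-coupling end of the monotone envelope — `⟨ū_P⟩_{β,L} → 1` as `β → ∞` on every
# fixed torus (large-`N` supplement 17, part 4)

HONEST FRAMING (cell `pub-gaugeboot`, page 1 of every file): certified bounds on lattice
expectations at STATED coupling, gauge group, dimension and torus size; NOT a mass gap, NOT a
continuum limit, NOT a string tension, NOT large `N`; NOT Yang–Mills-summit-bearing (barriers
`FixedCouplingUltralocality`, `PerturbativeInvisibility`).  A statement about a FIXED torus as the
coupling grows; nothing is uniform in `L`, nothing is said about the order of the limits `L → ∞`,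
`β → ∞`, and no rate is claimed.  This file certifies no number.

## Content

The tree's Laplace bound `wilsonExpectation_wilsonAction_le_laplace` (`WilsonEnergyConvexity`:
`⟨S⟩_β ≤ 2ε − (2/β) log Haar^{⊗E}{S ≤ ε}` for `β > 0`, `ε > 0`, with the small-ball mass positive)
gives, for every compact `G`, every continuous `ρ` (so `Re tr ρ ≤ N` by the unitary trick), every
`d` and every torus side `L`:

* ★ `tendsto_wilsonExpectation_wilsonAction_atTop` — the mean Wilson action `⟨S⟩_{β,L} → 0` as `β → ∞`;
* ★★ `tendsto_wilsonExpectation_meanPlaquette_atTop` — the mean plaquette `⟨ū_P⟩_{β,L} → 1`;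
* ★★ `tendsto_plaquetteExpectation_atTop` — in the cell's vocabulary, for `SU(N)`, `N ≥ 1`, `D ≥ 2`:
  `plaquetteExpectation N D L β_std → 1` as `β_std → ∞`;
  `iSup_plaquetteExpectation_eq_one` — with the monotone envelope (A17,
  `monotone_wilsonExpectation_meanPlaquette`) the supremum over the coupling is exactly `1`
  (never attained for `N ≥ 2`: `TorusWilsonLoopStrict.plaquetteExpectation_lt_one`);
  `eventually_lt_plaquetteExpectation` — every `a < 1` is a valid certified LOWER bound at all
  sufficiently large couplings on the fixed torus (qualitative: the threshold is not computed).

So on each torus the envelope `β ↦ ⟨ū_P⟩_β` is non-decreasing (A17), `< 1` (supplement 16) and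
exhausts `[⟨ū_P⟩_0, 1)` from `β = 0` upwards; certified upper windows `b < 1` at a stated `β_std`
are therefore statements with content at every coupling, and no window can have `a = 1`.
[folklore] (Laplace principle for Gibbs measures on compact spaces.)
-/

noncomputable section

open MeasureTheory Filter Topology
open Literature.MathematicalPhysics.QuantumFieldTheory
open Literature.RepresentationTheory.CompactGroups

namespace Summit.QuantumFields.GaugeBoot

section General

variable {d L N : ℕ} {G : Type*} [Group G] [TopologicalSpace G] [IsTopologicalGroup G]
  [CompactSpace G] [MeasurableSpace G] [BorelSpace G] (ρ : G →* Matrix (Fin N) (Fin N) ℂ)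

omit [MeasurableSpace G] [BorelSpace G] in
/-- `Re tr ρ(g) ≤ N` for a continuous `N`-dimensional representation of a compact group (unitary
trick, tree `CompactGroup.abs_re_trace_le_card`). [folklore] -/
theorem re_trace_le_of_continuous (hρ : Continuous ρ) (g : G) : ((ρ g).trace).re ≤ N := by
  have h := CompactGroup.abs_re_trace_le_card ρ hρ g
  rw [Fintype.card_fin] at h
  exact (le_abs_self _).trans h

/-- The mean Wilson action is non-negative (continuous `ρ`). [folklore] -/
theorem wilsonExpectation_wilsonAction_nonneg [NeZero L] (hρ : Continuous ρ) (β : ℝ) :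
    0 ≤ wilsonExpectation ρ β (wilsonAction (d := d) (L := L) (G := G) ρ) := by
  unfold wilsonExpectation
  exact integral_nonneg fun U => wilsonAction_nonneg_of_re_trace_le ρ (re_trace_le_of_continuous ρ hρ) U

/-- ★ **Weak-coupling limit of the mean action on a fixed torus**: `⟨S⟩_{β,L} → 0` as `β → ∞`
(every compact `G`, continuous `ρ`, every `d`, `L`). From the tree's Laplace bound
`⟨S⟩_β ≤ 2ε − (2/β) log Haar^{⊗E}{S ≤ ε}`. [folklore] -/
theorem tendsto_wilsonExpectation_wilsonAction_atTop [NeZero L] (hρ : Continuous ρ) :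
    Tendsto (fun β : ℝ => wilsonExpectation ρ β (wilsonAction (d := d) (L := L) (G := G) ρ)) atTop (𝓝 0) := by
  rw [tendsto_order]
  refine ⟨fun a ha => Eventually.of_forall fun β =>
    ha.trans_le (wilsonExpectation_wilsonAction_nonneg (d := d) (L := L) ρ hρ β), fun b hb => ?_⟩
  have hε : 0 < b / 3 := by positivity
  set C : ℝ := -2 * Real.log ((Measure.pi fun _ : Edge d L => haarProbability G).real
    {U : GaugeConfig d L G | wilsonAction ρ U ≤ b / 3}) with hC
  filter_upwards [eventually_gt_atTop (0 : ℝ), eventually_gt_atTop (3 * C / b)] with β hβ0 hβC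
  have h := wilsonExpectation_wilsonAction_le_laplace (d := d) (L := L) ρ hρ (re_trace_le_of_continuous ρ hρ) hβ0 hε
  have hCβ : -(2 / β * Real.log ((Measure.pi fun _ : Edge d L => haarProbability G).real
      {U : GaugeConfig d L G | wilsonAction ρ U ≤ b / 3})) = C / β := by
    rw [hC]; ring
  have h3C : 3 * C < β * b := (div_lt_iff₀ hb).1 hβC
  have hlt : C / β < b / 3 := by
    rw [div_lt_iff₀ hβ0]
    linarith
  linarith

/-- ★★ **Weak-coupling limit of the mean plaquette on a fixed torus**: `⟨ū_P⟩_{β,L} → 1` as `β → ∞`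
(`N ≥ 1`, a torus with plaquettes; every compact `G`, continuous `ρ`). [folklore] -/
theorem tendsto_wilsonExpectation_meanPlaquette_atTop [NeZero L] [Nonempty (Plaquette d L)] (hρ : Continuous ρ)
    (hN : N ≠ 0) :
    Tendsto (fun β : ℝ => wilsonExpectation ρ β (meanPlaquette (d := d) (L := L) (G := G) ρ)) atTop (𝓝 1) := by
  simp only [wilsonExpectation_meanPlaquette_eq ρ hρ hN]
  have h := (tendsto_wilsonExpectation_wilsonAction_atTop (d := d) (L := L) ρ hρ).div_const
    ((N : ℝ) * Fintype.card (Plaquette d L))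
  rw [zero_div] at h
  simpa using tendsto_const_nhds.sub h

/-- The mean plaquette tends to its supremum over the coupling, which is therefore `1`. [folklore] -/
theorem iSup_wilsonExpectation_meanPlaquette [NeZero L] [Nonempty (Plaquette d L)] (hρ : Continuous ρ) (hN : N ≠ 0) :
    (⨆ β : ℝ, wilsonExpectation ρ β (meanPlaquette (d := d) (L := L) (G := G) ρ)) = 1 := by
  have hbdd : BddAbove (Set.range fun β : ℝ => wilsonExpectation ρ β (meanPlaquette (d := d) (L := L) (G := G) ρ)) := by
    refine ⟨1, ?_⟩
    rintro _ ⟨β, rfl⟩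
    haveI := isProbabilityMeasure_wilsonMeasure (d := d) (L := L) (G := G) ρ hρ β
    refine (le_abs_self _).trans ?_
    unfold wilsonExpectation
    refine (abs_integral_le_integral_abs).trans ?_
    calc ∫ U, |meanPlaquette (d := d) (L := L) (G := G) ρ U| ∂wilsonMeasure ρ β ≤ ∫ _U, (1 : ℝ) ∂wilsonMeasure ρ β :=
          integral_mono_of_nonneg (Eventually.of_forall fun _ => abs_nonneg _) (integrable_const _)
            (Eventually.of_forall fun U => abs_meanPlaquette_le_one ρ hρ U)
      _ = 1 := by simp
  have hmono := monotone_wilsonExpectation_meanPlaquette (d := d) (L := L) (G := G) ρ hρ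
  exact tendsto_nhds_unique (tendsto_atTop_ciSup hmono hbdd)
    (tendsto_wilsonExpectation_meanPlaquette_atTop (d := d) (L := L) ρ hρ hN)

end General

/-! ## The cell's `plaquetteExpectation N D L β_std` -/

section Targets

variable {N D L : ℕ}

/-- ★★ **`plaquetteExpectation N D L β_std → 1` as `β_std → ∞`** (`SU(N)`, `N ≥ 1`, a torus with
plaquettes, e.g. `D ≥ 2`; tree coupling `β_std / N → ∞` with `β_std`). [folklore] -/
theorem tendsto_plaquetteExpectation_atTop [NeZero L] [Nonempty (Plaquette D L)] (hN : N ≠ 0) :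
    Tendsto (plaquetteExpectation N D L) atTop (𝓝 1) := by
  have hN' : (0 : ℝ) < N := by exact_mod_cast Nat.pos_of_ne_zero hN
  have h := tendsto_wilsonExpectation_meanPlaquette_atTop (d := D) (L := L) (suRep N) (continuous_suRep N) hN
  exact h.comp (tendsto_id.atTop_div_const hN')

/-- **The supremum of the envelope is `1`**: `⨆_{β_std} plaquetteExpectation N D L β_std = 1` (monotone,
A17, and the weak-coupling limit).  Not attained for `N ≥ 2` (`plaquetteExpectation_lt_one`). [folklore] -/
theorem iSup_plaquetteExpectation_eq_one [NeZero L] [Nonempty (Plaquette D L)] (hN : N ≠ 0) :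
    (⨆ β : ℝ, plaquetteExpectation N D L β) = 1 := by
  have hN' : (0 : ℝ) < N := by exact_mod_cast Nat.pos_of_ne_zero hN
  have hmono : Monotone (plaquetteExpectation N D L) := fun β β' h =>
    monotone_wilsonExpectation_meanPlaquette (d := D) (L := L) (suRep N) (continuous_suRep N)
      (div_le_div_of_nonneg_right h hN'.le)
  have hbdd : BddAbove (Set.range (plaquetteExpectation N D L)) := by
    refine ⟨1, ?_⟩
    rintro _ ⟨β, rfl⟩
    have h1 := iSup_wilsonExpectation_meanPlaquette (d := D) (L := L) (suRep N) (continuous_suRep N) hN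
    have hb : BddAbove (Set.range fun b : ℝ => wilsonExpectation (suRep N) b (meanPlaquette (d := D) (L := L) (suRep N))) := by
      by_contra hnb
      rw [Real.iSup_of_not_bddAbove hnb] at h1
      exact zero_ne_one h1
    exact h1 ▸ le_ciSup hb (β / N)
  exact tendsto_nhds_unique (tendsto_atTop_ciSup hmono hbdd) (tendsto_plaquetteExpectation_atTop hN)

/-- **Every `a < 1` is eventually a valid lower bound**: for all sufficiently large `β_std` (threshold
depending on `N, D, L, a`, not computed), `a < plaquetteExpectation N D L β_std`. [folklore] -/
theorem eventually_lt_plaquetteExpectation [NeZero L] [Nonempty (Plaquette D L)] (hN : N ≠ 0) {a : ℝ} (ha : a < 1) :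
    ∀ᶠ β in atTop, a < plaquetteExpectation N D L β :=
  (tendsto_order.1 (tendsto_plaquetteExpectation_atTop (D := D) (L := L) hN)).1 a ha

/-- The same as an explicit threshold with monotone continuation: there is `β₀` such that
`a < plaquetteExpectation N D L β` for EVERY `β ≥ β₀`. [folklore] -/
theorem exists_forall_ge_lt_plaquetteExpectation [NeZero L] [Nonempty (Plaquette D L)] (hN : N ≠ 0) {a : ℝ}
    (ha : a < 1) : ∃ β₀ : ℝ, ∀ β, β₀ ≤ β → a < plaquetteExpectation N D L β :=
  eventually_atTop.1 (eventually_lt_plaquetteExpectation (D := D) (L := L) hN ha)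

end Targets

/-! ## The same with the dimension hypothesis `2 ≤ D` in place of the `Nonempty (Plaquette D L)` instance -/

section TargetsDim

variable {N D L : ℕ}

/-- A torus of dimension `D ≥ 2` has plaquettes (the `(0,1)`-plaquette at the origin). [folklore] -/
theorem nonempty_plaquette_of_two_le (hD : 2 ≤ D) : Nonempty (Plaquette D L) :=
  ⟨(0, ⟨(⟨0, by omega⟩, ⟨1, by omega⟩), Fin.mk_lt_mk.2 Nat.zero_lt_one⟩)⟩

/-- ★★ **`plaquetteExpectation N D L β_std → 1` as `β_std → ∞`** for `N ≥ 1`, `D ≥ 2`, every `L`. [folklore] -/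
theorem tendsto_plaquetteExpectation_atTop' [NeZero L] (hN : N ≠ 0) (hD : 2 ≤ D) :
    Tendsto (plaquetteExpectation N D L) atTop (𝓝 1) := by
  haveI := nonempty_plaquette_of_two_le (L := L) hD
  exact tendsto_plaquetteExpectation_atTop hN

/-- **`⨆_{β_std} plaquetteExpectation N D L β_std = 1`** for `N ≥ 1`, `D ≥ 2`, every `L`. [folklore] -/
theorem iSup_plaquetteExpectation_eq_one' [NeZero L] (hN : N ≠ 0) (hD : 2 ≤ D) :
    (⨆ β : ℝ, plaquetteExpectation N D L β) = 1 := by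
  haveI := nonempty_plaquette_of_two_le (L := L) hD
  exact iSup_plaquetteExpectation_eq_one hN

/-- **Every `a < 1` is a valid lower bound at all large couplings** (`N ≥ 1`, `D ≥ 2`, every `L`; threshold
not computed). [folklore] -/
theorem exists_forall_ge_lt_plaquetteExpectation' [NeZero L] (hN : N ≠ 0) (hD : 2 ≤ D) {a : ℝ} (ha : a < 1) :
    ∃ β₀ : ℝ, ∀ β, β₀ ≤ β → a < plaquetteExpectation N D L β := by
  haveI := nonempty_plaquette_of_two_le (L := L) hD
  exact exists_forall_ge_lt_plaquetteExpectation hN ha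

end TargetsDim

/-! ## A conditional rate: `⟨S⟩_β = O(log β / β)` given a polynomial small-ball bound -/

section Rate

variable {d L N : ℕ} {G : Type*} [Group G] [TopologicalSpace G] [IsTopologicalGroup G]
  [CompactSpace G] [MeasurableSpace G] [BorelSpace G] (ρ : G →* Matrix (Fin N) (Fin N) ℂ)

/-- **Laplace rate, conditional on a small-ball bound.**  If the product Haar measure of the small-action
set satisfies `Haar^{⊗E}{S ≤ ε} ≥ c·ε^k` for `0 < ε ≤ 1`, then for every `β ≥ 1`:
`⟨S⟩_{β,L} ≤ (2 + 2k·log β − 2·log c)/β` (the tree's Laplace bound at `ε = 1/β`).  The small-ball bound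
itself (with `k = dim G · |E| / 2`-type exponents) is NOT proved here; it is the hypothesis. [folklore] -/
theorem wilsonExpectation_wilsonAction_le_of_smallBall [NeZero L] (hρ : Continuous ρ) {c : ℝ} {k : ℕ} (hc : 0 < c)
    (hsb : ∀ ε : ℝ, 0 < ε → ε ≤ 1 →
      c * ε ^ k ≤ (Measure.pi fun _ : Edge d L => haarProbability G).real {U : GaugeConfig d L G | wilsonAction ρ U ≤ ε})
    {β : ℝ} (hβ : 1 ≤ β) :
    wilsonExpectation ρ β (wilsonAction (d := d) (L := L) (G := G) ρ) ≤ (2 + 2 * k * Real.log β - 2 * Real.log c) / β := by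
  have hβ0 : 0 < β := lt_of_lt_of_le one_pos hβ
  have hε : (0 : ℝ) < 1 / β := by positivity
  have hε1 : 1 / β ≤ 1 := by rw [div_le_one hβ0]; exact hβ
  have h := wilsonExpectation_wilsonAction_le_laplace (d := d) (L := L) ρ hρ (re_trace_le_of_continuous ρ hρ) hβ0 hε
  set p : ℝ := (Measure.pi fun _ : Edge d L => haarProbability G).real {U : GaugeConfig d L G | wilsonAction ρ U ≤ 1 / β}
  have hp : c * (1 / β) ^ k ≤ p := hsb _ hε hε1
  have hcpos : 0 < c * (1 / β) ^ k := by positivity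
  have hlog : Real.log c - k * Real.log β ≤ Real.log p := by
    have h1 := Real.log_le_log hcpos hp
    rw [Real.log_mul hc.ne' (by positivity), Real.log_pow, one_div, Real.log_inv] at h1
    linarith
  have hβinv : 2 * (1 / β) - 2 / β * Real.log p ≤ (2 + 2 * k * Real.log β - 2 * Real.log c) / β := by
    rw [show 2 * (1 / β) - 2 / β * Real.log p = (2 - 2 * Real.log p) / β by ring]
    exact div_le_div_of_nonneg_right (by linarith) hβ0.le
  exact h.trans hβinv

/-- The same for the mean plaquette: `1 − ⟨ū_P⟩_{β,L} ≤ (2 + 2k log β − 2 log c)/(β·N·#P)` for `β ≥ 1`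
(tree coupling `β`), conditional on the small-ball bound. [folklore] -/
theorem one_sub_wilsonExpectation_meanPlaquette_le_of_smallBall [NeZero L] [Nonempty (Plaquette d L)] (hρ : Continuous ρ)
    (hN : N ≠ 0) {c : ℝ} {k : ℕ} (hc : 0 < c)
    (hsb : ∀ ε : ℝ, 0 < ε → ε ≤ 1 →
      c * ε ^ k ≤ (Measure.pi fun _ : Edge d L => haarProbability G).real {U : GaugeConfig d L G | wilsonAction ρ U ≤ ε})
    {β : ℝ} (hβ : 1 ≤ β) :
    1 - wilsonExpectation ρ β (meanPlaquette (d := d) (L := L) (G := G) ρ) ≤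
      (2 + 2 * k * Real.log β - 2 * Real.log c) / β / (N * Fintype.card (Plaquette d L)) := by
  rw [wilsonExpectation_meanPlaquette_eq ρ hρ hN, sub_sub_cancel]
  have hP : (0 : ℝ) < N * Fintype.card (Plaquette d L) := by
    have h1 : (0 : ℝ) < N := by exact_mod_cast Nat.pos_of_ne_zero hN
    have h2 : (0 : ℝ) < Fintype.card (Plaquette d L) := by exact_mod_cast Fintype.card_pos
    positivity
  exact div_le_div_of_nonneg_right (wilsonExpectation_wilsonAction_le_of_smallBall (d := d) (L := L) ρ hρ hc hsb hβ) hP.le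

end Rate

end Summit.QuantumFields.GaugeBoot

end
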